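import Mathlib
import Literature.NumberTheory.LFunctions.Zhang2022.TypedSection16BE
import Literature.NumberTheory.LFunctions.Zhang2022.AppendixALemma161Typed
import HarnessLib

/-!
# Zhang (2022) §16 (16.13)–(16.16) at a PARAMETRISED value of `e″₁ⱼ` (RT-05 E-ports): the sub-leaves of
# record ⇒ the two-piece (16.16) `Eq16_16R2E e1pp` (E-forms of `step16_u042R2_of_repair`,
# `eq16_16R2_of`, `eq16_16R2_of_subleaves`)

Topic `Literature/NumberTheory/LFunctions/Zhang2022` (Landau–Siegel audit tree; verdict-neutral).
Y. Zhang, *Discrete mean estimates and the Landau–Siegel zero*, arXiv:2211.02515v1 (2022)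
[Zhang2022LandauSiegel] — **an unrefereed manuscript under adjudication**; the displays referred to are
CLAIM nodes of `Typed.Section16B` / `TypedSection16BE`, stated not asserted; nothing here bears on
Theorems 1–2 of the source or on Landau–Siegel zeros. ZHANG-L discharge lane (seat zl-libC-typer, R-10
float), zl-lead rulings R-22/R-28 = RE-TYPE RT-05 (the `e″₁ⱼ`-fork; zl-ref-chief conditions C1–C5;
RETYPE-LEDGER row RT-05) on top of RT-03 (R-17, the two-piece (16.16) `Eq16_16R2`).

WHY. The skeleton binder of record for leaf h16_16 becomes `Typed.Section16B.Eq16_16R2E AppendixB.e1ppD c′`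
(the two-piece (16.16) with `𝔢ⱼ := frakeE e1ppD j`, the DERIVED `e″₁ⱼ = −jπi·b*` of Appendix B's own
computation — rows G-L4t10-1 / G-num2-1 / D-G-num2-1 — instead of the STATED `e1ppj`), and its producer
must therefore be available AT THE PARAMETER `e1pp : ℕ → ℂ` (R-28 C4: every edge re-elaborated generically;
the printed instances are recovered at `e1pp = e1ppj` by `rfl`, `TypedSection16BE.eq16_16R2E_e1ppj` etc.).
This file is the E-form of zl-w16-p4's `Section16Eq1616R2` (p473530): the SAME bookkeeping, with
`frake j ↦ frakeE e1pp j` — the proofs never inspect the value of `𝔢ⱼ` (the only `𝔢`-fact used there,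
`norm_frake_le_of_mem : ‖𝔢ⱼ‖ ≤ ‖𝔢₁‖ + ‖𝔢₂‖`, holds for every family and is re-proved at the parameter as
`norm_frakeE_le_of_mem`). PROVED here (theorems only; no definitions, no named facts):

* `calS2_sub_main_eq_of_eq16_13E` — the exact splitting "Inserting this into (16.13)" of
  `Typed.Section16B.calS2_sub_main_eq_of_eq16_13` with `𝔢ⱼ ↦ 𝔢ⱼ[e1pp]` (a `ring` identity under (16.13));
* `step16_u042R2E_of_repair` — `Eq16_15E e1pp → Inline16_nsetRemovableE e1pp → Step16_u040a → Step16_u040b →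
  Step16_u041aR → Step16_u041bR → Step16_u042R2E e1pp` ((16.15), the `𝔫(𝔮)`-removal, u040 and the repaired
  u041 — `Typed.Section16B.sumLtT_eval_of_repair`, which is `𝔢`-free — give u042 with the two-piece error
  `O(𝓛⁻¹ + (1+|L′|)³𝓛⁻⁴)` at the parameter);
* `eq16_16R2E_of` — (16.13) + `Step16_u042R2E e1pp` + Lemma 16.1 ⇒ `Eq16_16R2E e1pp` (algebra of
  `eq16_16R2_of`: `|𝓜₂*(1−β_j)| ≤ 4 + C`, `|𝓜₂*(1−β_j) − 𝔭| ≤ C𝓛⁻⁸ ≤ C𝓛⁻⁴`, `|(𝔞𝔢ⱼ/𝔭)(φ/D)L′| ≤ 2E(1+|L′|)³`,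
  `E := ‖𝔢₁[e1pp]‖ + ‖𝔢₂[e1pp]‖`);
* `eq16_16R2E_of_subleaves` — **the RT-03 × RT-05 internal assembly**: `Eq16_15E e1pp →
  Inline16_nsetRemovableE e1pp → Step16_u040a → Step16_u040b → Step16_u041aR → Lemma162R → Eq16_16R2E e1pp`,
  Lemma 16.1 being the tree theorem `AppendixA.lemma161_holds` and `Step16_u041bR ⇐ Lemma162R` the tree's
  `step16_u041bR_of_u039R ∘ step16_u039R_of_lemma162R` (signature = zl-w16-typer's ask, INBOX 00:05:36Z);
* `eq16_16R2E_of_subleaves_e1ppj` — sanity bridge: at `e1pp = e1ppj` this IS p473530's statement (by `rfl`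
  on the node bridges).

In words, at the instance of record `e1pp = AppendixB.e1ppD`: these are the displays (16.15)–(16.16) of §16
with the DERIVED constant `e″₁ⱼ = −jπi·b*` (App. B's own computation), NOT the value stated in Lemma 15.1/(B.3);
vs PRINT (R-23): REPAIRED-OF-RECORD per rows G-L4t5-1/G-L4t5-2/G-d57-1 (rate) and G-L4t10-1/G-num2-1 (constant).

## References

* Y. Zhang, arXiv:2211.02515v1 (2022), §16 (16.13)–(16.16) pp. 93–95, tex L4580–L4673; §15 Lemma 15.1
  p. 86; App. A p. 105 (Lemmas 16.1–16.2); App. B (B.3) p. 107. [cite: Zhang2022LandauSiegel, §16 (16.16) p.95]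
-/

noncomputable section

open Complex Real
open Literature.NumberTheory.LFunctions.Zhang2022
open Literature.NumberTheory.LFunctions.Zhang2022.Skeleton
open Literature.NumberTheory.LFunctions.Zhang2022.Typed.Section16A

namespace Literature.NumberTheory.LFunctions.Zhang2022.Typed.Section16B

variable (e1pp : ℕ → ℂ) (c' : ℝ)

/-! ## Two constant-agnostic facts at the parameter -/

/-- `‖𝔢ⱼ[e1pp]‖ ≤ ‖𝔢₁[e1pp]‖ + ‖𝔢₂[e1pp]‖` for `j ∈ {1, 2}` — the E-form of
`Typed.Section16B.norm_frake_le_of_mem`, valid for EVERY parameter `e1pp` (a uniform constant for the two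
cases; no property of `𝔢ⱼ` is used). [cite: Zhang2022LandauSiegel, §15 (15.2)] -/
theorem norm_frakeE_le_of_mem {j : ℕ} (hj : j ∈ ({1, 2} : Finset ℕ)) :
    ‖frakeE e1pp j‖ ≤ ‖frakeE e1pp 1‖ + ‖frakeE e1pp 2‖ := by
  simp only [Finset.mem_insert, Finset.mem_singleton] at hj
  rcases hj with rfl | rfl
  · exact le_add_of_nonneg_right (norm_nonneg _)
  · exact le_add_of_nonneg_left (norm_nonneg _)

/-- **"Inserting this into (16.13)", the exact algebra, at the parameter `e″ = e1pp`** (§16 p. 95, tex L4670;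
E-form of `calS2_sub_main_eq_of_eq16_13`): under (16.13), `𝒮₂ⱼ − 𝔞𝔢ⱼ[e1pp](φ(D)/D)L′` splits as
`𝓜₂*(1−β_j)·[Σ_n b₁ϖ₂ⱼ/n − (𝔞𝔢ⱼ[e1pp]/𝔭)(φ(D)/D)L′] + (𝓜₂*(1−β_j) − 𝔭)·(𝔞𝔢ⱼ[e1pp]/𝔭)(φ(D)/D)L′ +
(𝔭/𝔭 − 1)·𝔞𝔢ⱼ[e1pp](φ(D)/D)L′` (a `ring` identity — the value of `𝔢ⱼ` is never inspected).
[cite: Zhang2022LandauSiegel, §16 (16.16) p.95] -/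
theorem calS2_sub_main_eq_of_eq16_13E (h : Eq16_13 c') :
    ForAllLarge fun D _ χ => AssumptionA D χ → ∀ j ∈ ({1, 2} : Finset ℕ),
      calS2 c' χ j - (frakA χ : ℂ) * frakeE e1pp j * ((Nat.totient D : ℂ) / (D : ℂ)) *
          deriv χ.LFunction 1 =
        calM2star c' χ (1 - betaJ c' D j) *
            ((∑ n ∈ Finset.Ico 1 ⌈bigP D⌉₊, b1coef c' χ n * varpi2 c' χ j n / (n : ℂ)) -
              (frakA χ : ℂ) * frakeE e1pp j / frakp χ * ((Nat.totient D : ℂ) / (D : ℂ)) *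
                deriv χ.LFunction 1) +
          (calM2star c' χ (1 - betaJ c' D j) - frakp χ) *
            ((frakA χ : ℂ) * frakeE e1pp j / frakp χ * ((Nat.totient D : ℂ) / (D : ℂ)) *
              deriv χ.LFunction 1) +
          (frakp χ / frakp χ - 1) *
            ((frakA χ : ℂ) * frakeE e1pp j * ((Nat.totient D : ℂ) / (D : ℂ)) * deriv χ.LFunction 1) := by
  obtain ⟨D₀, hC⟩ := h
  refine ⟨D₀, fun D _ χ hD hq hp hA j hj => ?_⟩
  rw [hC D χ hD hq hp hA j hj]
  ring

/-- Any real threshold on `𝓛 = log D` is met for all large `D`. [folklore] -/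
private theorem exists_forall_le_ell_E (M : ℝ) : ∃ D₀ : ℕ, ∀ D : ℕ, D₀ ≤ D → M ≤ ell D := by
  refine ⟨⌈Real.exp M⌉₊ + 1, fun D hD => ?_⟩
  have hD1 : (⌈Real.exp M⌉₊ : ℝ) + 1 ≤ D := by exact_mod_cast hD
  have hD0 : (0 : ℝ) < D := by linarith [Nat.le_ceil (Real.exp M), Real.exp_pos M]
  rw [ell, Real.le_log_iff_exp_le hD0]
  linarith [Nat.le_ceil (Real.exp M)]

/-! ## u042 with the two-piece error, at the parameter -/

open scoped Classical in
/-- **u042 with the two-piece error, at the parameter `e″ = e1pp`** (§16 p. 94, tex L4667, DAG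
`Z22:§16.u042` in the repaired chain; E-form of zl-w16-p4's `step16_u042R2_of_repair`):
`Σ_n b₁(n)ϖ₂ⱼ(n)/n = (𝔞𝔢ⱼ[e1pp]/𝔭)(φ(D)/D)L′(1,χ) + O(𝓛⁻¹ + (1+|L′(1,χ)|)³𝓛⁻⁴)` — i.e. the node
`Step16_u042R2E e1pp c′` — from (16.15) at the parameter (`Eq16_15E`), the `𝔫(𝔮)`-removal at the
parameter (`Inline16_nsetRemovableE`), u040 and the repaired u041 (`sumLtT_eval_of_repair`, `𝔢`-free):
the three errors `C₁𝓛⁻¹`, `C₂𝓛⁻¹`, `|𝔢ⱼ[e1pp]|C₀(1+|L′|)³𝓛⁻⁴` added without merging.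
[cite: Zhang2022LandauSiegel, §16 p.94 (u042)] -/
theorem step16_u042R2E_of_repair (h15 : Eq16_15E e1pp c') (hrem : Inline16_nsetRemovableE e1pp c')
    (h40a : Step16_u040a c') (h40b : Step16_u040b c') (h41a : Step16_u041aR c')
    (h41b : Step16_u041bR c') : Step16_u042R2E e1pp c' := by
  obtain ⟨C₁, D₁, h₁⟩ := h15
  obtain ⟨C₂, D₂, h₂⟩ := hrem
  obtain ⟨C₀, D₀, h₀⟩ := sumLtT_eval_of_repair c' h40a h40b h41a h41b
  obtain ⟨D₃, hD₃⟩ := exists_forall_le_ell_E 1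
  set E : ℝ := ‖frakeE e1pp 1‖ + ‖frakeE e1pp 2‖ with hE
  refine ⟨max C₁ 0 + max C₂ 0 + E * max C₀ 0,
    max (max D₁ D₂) (max D₀ D₃), fun D _ χ hD hq hp hA j hj => ?_⟩
  have hD₁ : D₁ ≤ D := le_trans (le_trans (le_max_left _ _) (le_max_left _ _)) hD
  have hD₂ : D₂ ≤ D := le_trans (le_trans (le_max_right _ _) (le_max_left _ _)) hD
  have hD₀ : D₀ ≤ D := le_trans (le_trans (le_max_left _ _) (le_max_right _ _)) hD
  have hℓ1 : (1 : ℝ) ≤ ell D := hD₃ D (le_trans (le_trans (le_max_right _ _) (le_max_right _ _)) hD)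
  have hℓ0 : 0 < ell D := by linarith
  have hinv0 : 0 ≤ (ell D)⁻¹ := inv_nonneg.mpr hℓ0.le
  have e₁ := h₁ D χ hD₁ hq hp hA j hj
  have e₂ := h₂ D χ hD₂ hq hp hA j hj
  have e₀ := h₀ D χ hD₀ hq hp hA j hj
  have hEj : ‖frakeE e1pp j‖ ≤ E := norm_frakeE_le_of_mem e1pp hj
  set x : ℝ := ‖deriv χ.LFunction 1‖ with hx
  have hx0 : 0 ≤ x := norm_nonneg _
  set Y : ℝ := (1 + x) ^ 3 * (ell D ^ 4)⁻¹ with hY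
  have hY0 : 0 ≤ Y := by positivity
  -- abbreviations
  set A := ∑ n ∈ Finset.Ico 1 ⌈bigP D⌉₊, b1coef c' χ n * varpi2 c' χ j n / (n : ℂ) with hA'
  set F := ∑ n₁ ∈ (Finset.Ico 1 ⌈bigT D⌉₊).filter (fun n₁ => n₁ ∈ nset (frakq D)),
    varpi2 c' χ j n₁ * nuConvChi χ n₁ / (n₁ : ℂ) with hF
  set S := ∑ n ∈ Finset.Ico 1 ⌈bigT D⌉₊, varpi2 c' χ j n * nuConvChi χ n / (n : ℂ) with hS
  set M := (frakA χ : ℂ) / frakp χ * ((Nat.totient D : ℂ) / (D : ℂ)) * deriv χ.LFunction 1 with hM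
  have hmain : (frakA χ : ℂ) * frakeE e1pp j / frakp χ * ((Nat.totient D : ℂ) / (D : ℂ)) *
      deriv χ.LFunction 1 = frakeE e1pp j * M := by rw [hM]; ring
  rw [hmain]
  have hsplit : A - frakeE e1pp j * M = (A - frakeE e1pp j * F) +
      (frakeE e1pp j * F - frakeE e1pp j * S) + frakeE e1pp j * (S - M) := by ring
  have e₀' : ‖S - M‖ ≤ max C₀ 0 * Y := by
    refine le_trans e₀ ?_
    calc C₀ * (1 + x) ^ 3 * (ell D ^ 4)⁻¹ ≤ max C₀ 0 * (1 + x) ^ 3 * (ell D ^ 4)⁻¹ :=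
          mul_le_mul_of_nonneg_right (mul_le_mul_of_nonneg_right (le_max_left _ _) (by positivity))
            (inv_nonneg.mpr (pow_nonneg hℓ0.le 4))
      _ = max C₀ 0 * Y := by rw [hY]; ring
  have t3 : ‖frakeE e1pp j * (S - M)‖ ≤ E * max C₀ 0 * Y := by
    rw [norm_mul]
    calc ‖frakeE e1pp j‖ * ‖S - M‖ ≤ E * (max C₀ 0 * Y) :=
          mul_le_mul hEj e₀' (norm_nonneg _) (le_trans (norm_nonneg _) hEj)
      _ = E * max C₀ 0 * Y := by ring
  have t1 : ‖A - frakeE e1pp j * F‖ ≤ max C₁ 0 * (ell D)⁻¹ :=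
    le_trans e₁ (mul_le_mul_of_nonneg_right (le_max_left _ _) hinv0)
  have t2 : ‖frakeE e1pp j * F - frakeE e1pp j * S‖ ≤ max C₂ 0 * (ell D)⁻¹ :=
    le_trans e₂ (mul_le_mul_of_nonneg_right (le_max_left _ _) hinv0)
  have hC₁0 : 0 ≤ max C₁ 0 := le_max_right _ _
  have hC₂0 : 0 ≤ max C₂ 0 := le_max_right _ _
  have hC₀0 : 0 ≤ max C₀ 0 := le_max_right _ _
  have hE0 : 0 ≤ E := le_trans (norm_nonneg _) hEj
  calc ‖A - frakeE e1pp j * M‖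
      = ‖(A - frakeE e1pp j * F) + (frakeE e1pp j * F - frakeE e1pp j * S) +
          frakeE e1pp j * (S - M)‖ := by rw [hsplit]
    _ ≤ ‖A - frakeE e1pp j * F‖ + ‖frakeE e1pp j * F - frakeE e1pp j * S‖ +
          ‖frakeE e1pp j * (S - M)‖ := by
        have u1 : ‖(A - frakeE e1pp j * F) + (frakeE e1pp j * F - frakeE e1pp j * S)‖ ≤
            ‖A - frakeE e1pp j * F‖ + ‖frakeE e1pp j * F - frakeE e1pp j * S‖ := norm_add_le _ _
        have u2 := norm_add_le ((A - frakeE e1pp j * F) + (frakeE e1pp j * F - frakeE e1pp j * S))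
          (frakeE e1pp j * (S - M))
        linarith
    _ ≤ max C₁ 0 * (ell D)⁻¹ + max C₂ 0 * (ell D)⁻¹ + E * max C₀ 0 * Y := add_le_add (add_le_add t1 t2) t3
    _ ≤ (max C₁ 0 + max C₂ 0 + E * max C₀ 0) * ((ell D)⁻¹ + Y) := by
        nlinarith [mul_nonneg hC₁0 hY0, mul_nonneg hC₂0 hY0, mul_nonneg (mul_nonneg hE0 hC₀0) hinv0]
    _ = (max C₁ 0 + max C₂ 0 + E * max C₀ 0) *
          ((ell D)⁻¹ + (1 + x) ^ 3 * (ell D ^ 4)⁻¹) := by rw [hY]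

/-! ## (16.13) + u042ᴿ²ᴱ + Lemma 16.1 ⇒ (16.16)ᴿ²ᴱ -/

/-- **The two-piece (16.16) at the parameter `e″ = e1pp` from (16.13), the two-piece u042 at the
parameter and Lemma 16.1** (§16 p. 95, tex L4670: "Inserting this into (16.13) and applying Lemma 16.1 we
obtain (16.16)"; E-form of zl-w16-p4's `eq16_16R2_of`): `Eq16_13 c′ → Step16_u042R2E e1pp c′ → Lemma161 c′ →
Eq16_16R2E e1pp c′`. The algebra of `Typed.Section16B.eq16_16R_of` with the error kept in two pieces —
exact splitting `calS2_sub_main_eq_of_eq16_13E`, `|𝓜₂*(1−β_j)| ≤ 4 + C` (`norm_frakp_le_four`, Lemma 16.1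
at `s = 1−β_j`, `|β_j| < 5α`), `|𝓜₂*(1−β_j) − 𝔭| ≤ C𝓛⁻⁸`, `|(𝔞𝔢ⱼ[e1pp]/𝔭)(φ/D)L′| ≤ 2E(1+|L′|)³`
(`|𝔭| ≥ 1/2`, `𝔞 ≤ |L′|²`, `E = ‖𝔢₁[e1pp]‖ + ‖𝔢₂[e1pp]‖`) and `𝓛⁻⁸ ≤ 𝓛⁻⁴`. No upper bound for `L′(1,χ)`
and no property of `𝔢ⱼ[e1pp]` are used. [cite: Zhang2022LandauSiegel, §16 (16.16) p.95] -/
theorem eq16_16R2E_of (h13 : Eq16_13 c') (h42 : Step16_u042R2E e1pp c') (h161 : Lemma161 c') :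
    Eq16_16R2E e1pp c' := by
  obtain ⟨D₃, h₃⟩ := calS2_sub_main_eq_of_eq16_13E e1pp c' h13
  obtain ⟨C₄, D₄, h₄⟩ := h42
  obtain ⟨C_L, D_L, hL⟩ := h161
  set E : ℝ := ‖frakeE e1pp 1‖ + ‖frakeE e1pp 2‖ with hE
  set L₀ : ℝ := max 3 (Real.pi * (5 * |c'| + 1)) with hL₀
  obtain ⟨D₅, hD₅⟩ := exists_forall_le_ell_E L₀
  refine ⟨(4 + max C_L 0) * max C₄ 0 + max C_L 0 * (2 * E),
    max (max D₃ D₄) (max D_L D₅), fun D _ χ hD hq hp hA j hj => ?_⟩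
  have hD₃ : D₃ ≤ D := le_trans (le_trans (le_max_left _ _) (le_max_left _ _)) hD
  have hD₄ : D₄ ≤ D := le_trans (le_trans (le_max_right _ _) (le_max_left _ _)) hD
  have hD_L : D_L ≤ D := le_trans (le_trans (le_max_left _ _) (le_max_right _ _)) hD
  have hℓL₀ : L₀ ≤ ell D := hD₅ D (le_trans (le_trans (le_max_right _ _) (le_max_right _ _)) hD)
  have hℓ3 : 3 ≤ ell D := le_trans (le_max_left _ _) hℓL₀
  have hℓπ : Real.pi * (5 * |c'| + 1) ≤ ell D := le_trans (le_max_right _ _) hℓL₀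
  have hℓ2 : 2 ≤ ell D := by linarith
  have hℓ1 : 1 ≤ ell D := by linarith
  have hℓ0 : 0 < ell D := by linarith
  have hinv0 : 0 ≤ (ell D)⁻¹ := inv_nonneg.mpr hℓ0.le
  -- the inputs at this `D`, `χ`, `j`
  have eId := h₃ D χ hD₃ hq hp hA j hj
  have e42 := h₄ D χ hD₄ hq hp hA j hj
  -- Lemma 16.1 at `s = 1 − β_j`, `d = l = 1`
  have hdl : ((1 * 1 : ℕ) : ℝ) < bigP D / bigT D ^ 2 := by
    have hT : 0 < bigT D ^ 2 := pow_pos (Real.exp_pos _) 2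
    rw [Nat.cast_mul, Nat.cast_one, mul_one, lt_div_iff₀ hT, one_mul]
    exact bigT_sq_lt_bigP hℓ2
  have hs : ‖(1 - betaJ c' D j) - 1‖ < 5 * alpha D := by
    rw [sub_sub_cancel_left, norm_neg]
    exact norm_betaJ_lt_five_alpha hℓ2 hℓπ hj
  have e161 : ‖calM2star c' χ (1 - betaJ c' D j) - frakp χ‖ ≤ C_L * (ell D ^ 8)⁻¹ :=
    hL D χ hD_L hq hp hA 1 1 le_rfl le_rfl hdl (1 - betaJ c' D j) hs
  -- sizes
  have hp4 := norm_frakp_le_four χ hq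
  have hp2 := half_le_norm_frakp χ hq
  have hpne : frakp χ ≠ 0 := by
    intro h0
    rw [h0, norm_zero] at hp2
    norm_num at hp2
  have h8' : 0 ≤ (ell D ^ 8)⁻¹ := inv_nonneg.mpr (pow_nonneg hℓ0.le 8)
  have h8 : (ell D ^ 8)⁻¹ ≤ 1 := inv_le_one_of_one_le₀ (one_le_pow₀ hℓ1)
  have h84 : (ell D ^ 8)⁻¹ ≤ (ell D ^ 4)⁻¹ :=
    inv_anti₀ (pow_pos hℓ0 4) (pow_le_pow_right₀ hℓ1 (by norm_num))
  have h40 : 0 ≤ (ell D ^ 4)⁻¹ := inv_nonneg.mpr (pow_nonneg hℓ0.le 4)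
  have hMle : ‖calM2star c' χ (1 - betaJ c' D j)‖ ≤ 4 + max C_L 0 := by
    have htri : ‖calM2star c' χ (1 - betaJ c' D j)‖ ≤
        ‖calM2star c' χ (1 - betaJ c' D j) - frakp χ‖ + ‖frakp χ‖ := norm_le_norm_sub_add _ _
    have : C_L * (ell D ^ 8)⁻¹ ≤ max C_L 0 := by
      calc C_L * (ell D ^ 8)⁻¹ ≤ max C_L 0 * (ell D ^ 8)⁻¹ :=
            mul_le_mul_of_nonneg_right (le_max_left _ _) h8'
        _ ≤ max C_L 0 * 1 := mul_le_mul_of_nonneg_left h8 (le_max_right _ _)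
        _ = max C_L 0 := mul_one _
    linarith
  obtain ⟨hA0, hAle⟩ := frakA_nonneg_and_le_norm_sq χ
  have hEj : ‖frakeE e1pp j‖ ≤ E := norm_frakeE_le_of_mem e1pp hj
  have hE0 : 0 ≤ E := le_trans (norm_nonneg _) hEj
  have hφ : ‖((Nat.totient D : ℂ) / (D : ℂ))‖ ≤ 1 := by
    rw [norm_div, Complex.norm_natCast, Complex.norm_natCast]
    have hD0 : (0 : ℝ) < D := by exact_mod_cast Nat.pos_of_ne_zero (NeZero.ne D)
    rw [div_le_one hD0]
    exact_mod_cast Nat.totient_le D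
  set x : ℝ := ‖deriv χ.LFunction 1‖ with hx
  have hx0 : 0 ≤ x := norm_nonneg _
  set W : ℝ := (ell D)⁻¹ + (1 + x) ^ 3 * (ell D ^ 4)⁻¹ with hW
  have hW0 : 0 ≤ W := by positivity
  -- the main-term size: `‖(𝔞𝔢ⱼ[e1pp]/𝔭)(φ/D)L′‖ ≤ 2E(1+x)³`
  set Mj := (frakA χ : ℂ) * frakeE e1pp j / frakp χ * ((Nat.totient D : ℂ) / (D : ℂ)) *
    deriv χ.LFunction 1 with hMj
  have hMj_le : ‖Mj‖ ≤ 2 * E * (1 + x) ^ 3 := by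
    have h1 : ‖(frakA χ : ℂ) * frakeE e1pp j / frakp χ‖ ≤ x ^ 2 * E * 2 := by
      rw [norm_div, norm_mul, Complex.norm_real, Real.norm_of_nonneg hA0, div_le_iff₀ (by linarith)]
      have : frakA χ * ‖frakeE e1pp j‖ ≤ x ^ 2 * E :=
        mul_le_mul hAle hEj (norm_nonneg _) (sq_nonneg _)
      nlinarith [norm_nonneg (frakeE e1pp j), mul_nonneg hA0 (norm_nonneg (frakeE e1pp j)),
        mul_nonneg (sq_nonneg x) hE0]
    have hx3 : x ^ 2 * x ≤ (1 + x) ^ 3 := by nlinarith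
    calc ‖Mj‖ = ‖(frakA χ : ℂ) * frakeE e1pp j / frakp χ‖ * ‖((Nat.totient D : ℂ) / (D : ℂ))‖ * x := by
          rw [hMj, norm_mul, norm_mul]
      _ ≤ (x ^ 2 * E * 2) * 1 * x := by
          refine mul_le_mul_of_nonneg_right (mul_le_mul h1 hφ (norm_nonneg _) (by positivity)) hx0
      _ = 2 * E * (x ^ 2 * x) := by ring
      _ ≤ 2 * E * (1 + x) ^ 3 := mul_le_mul_of_nonneg_left hx3 (by positivity)
  -- assemble
  rw [eId]
  have hzero : frakp χ / frakp χ - 1 = 0 := by rw [div_self hpne, sub_self]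
  rw [hzero, zero_mul, add_zero]
  have t1 : ‖calM2star c' χ (1 - betaJ c' D j) *
      ((∑ n ∈ Finset.Ico 1 ⌈bigP D⌉₊, b1coef c' χ n * varpi2 c' χ j n / (n : ℂ)) - Mj)‖ ≤
      (4 + max C_L 0) * (max C₄ 0 * W) := by
    rw [norm_mul]
    refine mul_le_mul hMle (le_trans e42 ?_) (norm_nonneg _) (by positivity)
    exact mul_le_mul_of_nonneg_right (le_max_left _ _) hW0
  have t2 : ‖(calM2star c' χ (1 - betaJ c' D j) - frakp χ) * Mj‖ ≤
      max C_L 0 * (2 * E) * W := by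
    rw [norm_mul]
    calc ‖calM2star c' χ (1 - betaJ c' D j) - frakp χ‖ * ‖Mj‖
        ≤ (max C_L 0 * (ell D ^ 8)⁻¹) * (2 * E * (1 + x) ^ 3) :=
          mul_le_mul (le_trans e161 (mul_le_mul_of_nonneg_right (le_max_left _ _) h8')) hMj_le
            (norm_nonneg _) (by positivity)
      _ = max C_L 0 * (2 * E) * ((1 + x) ^ 3 * (ell D ^ 8)⁻¹) := by ring
      _ ≤ max C_L 0 * (2 * E) * ((1 + x) ^ 3 * (ell D ^ 4)⁻¹) :=
          mul_le_mul_of_nonneg_left (mul_le_mul_of_nonneg_left h84 (by positivity)) (by positivity)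
      _ ≤ max C_L 0 * (2 * E) * W := by
          refine mul_le_mul_of_nonneg_left ?_ (by positivity)
          rw [hW]; linarith
  calc ‖calM2star c' χ (1 - betaJ c' D j) *
          ((∑ n ∈ Finset.Ico 1 ⌈bigP D⌉₊, b1coef c' χ n * varpi2 c' χ j n / (n : ℂ)) - Mj) +
        (calM2star c' χ (1 - betaJ c' D j) - frakp χ) * Mj‖
      ≤ (4 + max C_L 0) * (max C₄ 0 * W) + max C_L 0 * (2 * E) * W :=
        le_trans (norm_add_le _ _) (add_le_add t1 t2)
    _ = ((4 + max C_L 0) * max C₄ 0 + max C_L 0 * (2 * E)) *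
          ((ell D)⁻¹ + (1 + x) ^ 3 * (ell D ^ 4)⁻¹) := by rw [hW]; ring

/-- **RT-03 × RT-05 internal assembly at the parameter `e″ = e1pp`** (zl-w16-typer's E-port ask, INBOX
00:05:36Z; E-form of zl-w16-p4's `eq16_16R2_of_subleaves`, p473530): the typed sub-leaves of record under
(16.16) — (16.15) at the parameter `Eq16_15E e1pp`, the `𝔫(𝔮)`-removal at the parameter
`Inline16_nsetRemovableE e1pp`, u040 `Step16_u040a/b`, the repaired contour step `Step16_u041aR` and the
repaired Lemma 16.2 `Lemma162R` (the last four `𝔢`-free) — imply the two-piece (16.16) at the parameter,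
`Eq16_16R2E e1pp c′`. Lemma 16.1 is the tree theorem `AppendixA.lemma161_holds` ((16.13) follows from it,
`eq16_13_of_lemma161`); `Step16_u041bR ⇐ Lemma162R` is `step16_u041bR_of_u039R ∘ step16_u039R_of_lemma162R`.
At `e1pp = AppendixB.e1ppD` the conclusion is the skeleton binder of record for leaf h16_16 (R-28).
[cite: Zhang2022LandauSiegel, §16 (16.13)–(16.16) pp.93–95] -/
theorem eq16_16R2E_of_subleaves (h15 : Eq16_15E e1pp c') (hrem : Inline16_nsetRemovableE e1pp c')
    (h40a : Step16_u040a c') (h40b : Step16_u040b c') (h41a : Step16_u041aR c')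
    (h162 : Lemma162R c') : Eq16_16R2E e1pp c' :=
  eq16_16R2E_of e1pp c' (eq16_13_of_lemma161 c' (AppendixA.lemma161_holds c'))
    (step16_u042R2E_of_repair e1pp c' h15 hrem h40a h40b h41a
      (step16_u041bR_of_u039R c' (step16_u039R_of_lemma162R c' h162)))
    (AppendixA.lemma161_holds c')

/-- Sanity bridge (R-28 C4): at the STATED constant `e1pp = e1ppj` the assembly above is an assembly of the
printed-constant nodes `Eq16_15 → Inline16_nsetRemovable → … → Eq16_16R2` (the node bridges
`eq16_15E_e1ppj`, `inline16_nsetRemovableE_e1ppj`, `eq16_16R2E_e1ppj` are `rfl`).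
[cite: Zhang2022LandauSiegel, §16 (16.16) p.95] -/
theorem eq16_16R2E_of_subleaves_e1ppj (h15 : Eq16_15 c') (hrem : Inline16_nsetRemovable c')
    (h40a : Step16_u040a c') (h40b : Step16_u040b c') (h41a : Step16_u041aR c')
    (h162 : Lemma162R c') : Eq16_16R2 c' := by
  rw [← eq16_16R2E_e1ppj]
  exact eq16_16R2E_of_subleaves e1ppj c' ((eq16_15E_e1ppj c').symm ▸ h15)
    ((inline16_nsetRemovableE_e1ppj c').symm ▸ hrem) h40a h40b h41a h162

end Literature.NumberTheory.LFunctions.Zhang2022.Typed.Section16B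

end
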